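import Mathlib
import Literature.AlgebraicGeometry.Resolution.ValuationIndependence
import Literature.AlgebraicGeometry.Resolution.KnafKuhlmann2009Prop23
import HarnessLib

/-!
# The centre of a valuation on the toric chart `K[x, y]`: it is the ideal of the `xᵢ` (Knaf–Kuhlmann 2005, §4)

Route `RadicialJung`, crux `CleanModels` (stmt-ResolutionOfSingularities-15917), line `Sketch` rev 35; explicit-unit seat `decomp-res-hand-1` g3.
GROUNDWORK (lemma M3, toric half, of `Cruxes/CleanModels/Lines/Sketch-memo-hand1-g3.md` §4) for the discharge of the printed input
`Literature.AlgebraicGeometry.Resolution.KnafKuhlmann2005_Thm11_monomialForm` (Knaf–Kuhlmann 2005, Thm. 1.1 WITH its monomial clause).  In the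
setting of Knaf–Kuhlmann's Thm. 4.1 (the tree's `knafKuhlmann2005_thm41_field`, whose docstring records that «`A_q` regular of dimension `ρ`, `ζ` an
`A_q`-monomial in `x'`» is NOT derived there): `K ⊆ 𝒪_V` (a `K`-trivial place), `x₁,…,x_ρ ≠ 0` of POSITIVE value with values ℤ-independent,
`y₁,…,y_τ ∈ 𝒪_V` with residues algebraically independent over `KP`.  Then on the polynomial chart `K[x, y] ⊆ 𝒪_V` the centre of `V` is EXACTLY the
ideal generated by the `xᵢ`: an element `F(x, y)` has value `< 1` iff `F` has no `x`-free term, by the dominant-term computation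
(`ValuationIndependence.exists_dominant_term`, Knaf–Kuhlmann Thm. 2.1: `v(F(x,y)) = v(x^{e₀})` for the dominant exponent `e₀`, the coefficients in
`K[y]` being units).  Consequently the local ring of the chart at the centre has the `xᵢ` as generators of its maximal ideal — the regular system of
parameters in which Knaf–Kuhlmann's monomial clause is read (the dimension count `dim = ρ` and the étale ascent are the remaining halves of M3).

* `eval₂Hom_mem_closure` — values of iterated polynomials lie in `K[x, y]`.
* `closure_le_valuationSubring` — `K[x, y] ⊆ 𝒪_V`.
* `valuation_lt_one_iff_exists_sum` — **the centre is `(x)`**: for `a ∈ K[x, y]`, `v a < 1 ↔ a = Σᵢ cᵢ · xᵢ` with `cᵢ ∈ K[x, y]` (values of polynomials).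

OURS (bookkeeping over the landed Thm. 2.1 machinery); proves nothing about resolution of singularities in characteristic `p`. counted 0.
-/

noncomputable section

set_option linter.dupNamespace false -- mandated namespace of this single-conjunct summit

open IsLocalRing
open Literature.AlgebraicGeometry.Resolution

namespace Summit.ResolutionOfSingularities.ResolutionOfSingularities.Theorems.RadicialJung.CleanModels

namespace KK05ValueBasis

universe u

variable {Ω : Type u} [Field Ω] (V : ValuationSubring Ω) (K : Subfield Ω)

/-- Values `F(x, y)` of iterated polynomials `F ∈ (K[Y])[X]` lie in the subring `K[x, y]`. [folklore] -/
theorem eval₂Hom_mem_closure {ρ τ : ℕ} (x : Fin ρ → Ω) (y : Fin τ → Ω)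
    (F : MvPolynomial (Fin ρ) (MvPolynomial (Fin τ) K)) :
    MvPolynomial.eval₂Hom (MvPolynomial.aeval y).toRingHom x F ∈
      Subring.closure ((K : Set Ω) ∪ (Set.range x ∪ Set.range y)) := by
  set R := Subring.closure ((K : Set Ω) ∪ (Set.range x ∪ Set.range y)) with hR
  have hC : ∀ p : MvPolynomial (Fin τ) K, (MvPolynomial.aeval y).toRingHom p ∈ R := by
    intro p
    induction p using MvPolynomial.induction_on with
    | C c =>
      change MvPolynomial.aeval y (MvPolynomial.C c) ∈ R
      rw [MvPolynomial.algHom_C]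
      exact Subring.subset_closure (Or.inl c.2)
    | add p q hp hq =>
      change MvPolynomial.aeval y (p + q) ∈ R
      rw [map_add]
      exact R.add_mem hp hq
    | mul_X p j hp =>
      change MvPolynomial.aeval y (p * MvPolynomial.X j) ∈ R
      rw [map_mul, MvPolynomial.aeval_X]
      exact R.mul_mem hp (Subring.subset_closure (Or.inr (Or.inr ⟨j, rfl⟩)))
  induction F using MvPolynomial.induction_on with
  | C p =>
    rw [MvPolynomial.eval₂Hom_C]
    exact hC p
  | add F G hF hG =>
    rw [map_add]
    exact R.add_mem hF hG
  | mul_X F i hF =>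
    rw [map_mul, MvPolynomial.eval₂Hom_X']
    exact R.mul_mem hF (Subring.subset_closure (Or.inr (Or.inl ⟨i, rfl⟩)))

/-- `K[x, y] ⊆ 𝒪_V` when `K ⊆ 𝒪_V`, the `xᵢ` have value `< 1` and the `yⱼ` lie in `𝒪_V`. [folklore] -/
theorem closure_le_valuationSubring (hKV : ∀ c ∈ K, c ∈ V) {ρ τ : ℕ} (x : Fin ρ → Ω) (y : Fin τ → Ω)
    (hx1 : ∀ i, V.valuation (x i) < 1) (hy : ∀ j, y j ∈ V) :
    Subring.closure ((K : Set Ω) ∪ (Set.range x ∪ Set.range y)) ≤ V.toSubring := by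
  refine Subring.closure_le.mpr ?_
  rintro z (hz | ⟨i, rfl⟩ | ⟨j, rfl⟩)
  · exact hKV z hz
  · exact (V.valuation_le_one_iff _).mp (hx1 i).le
  · exact hy j

/-- **The centre of `V` on the toric chart `K[x, y]` is the ideal `(x₁,…,x_ρ)`** (Knaf–Kuhlmann 2005, §4, the setting of Thm. 4.1): for `K ⊆ 𝒪_V`,
`xᵢ ≠ 0` of value `< 1` with ℤ-independent values, `yⱼ ∈ 𝒪_V` with residues algebraically independent over `KP`, an element `a ∈ K[x, y]` has
`v a < 1` if and only if `a = Σᵢ cᵢ xᵢ` with the `cᵢ` values of iterated polynomials (i.e. `cᵢ ∈ K[x, y]`).  The non-trivial direction is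
Knaf–Kuhlmann's Thm. 2.1 (`exists_dominant_term`): if the representing polynomial `F` had an `x`-free term `G(y) ≠ 0`, then `v(G(y)) = 1` would be
dominated by the dominant term, forcing `v a = v(x^{e₀}) = 1`. [cite: KnafKuhlmann2005, Thm. 2.1 and Thm. 4.1 (pp. 9–11)] -/
theorem valuation_lt_one_iff_exists_sum (hKV : ∀ c ∈ K, c ∈ V) {ρ τ : ℕ} (x : Fin ρ → Ω) (y : Fin τ → Ω)
    (hx0 : ∀ i, x i ≠ 0) (hx1 : ∀ i, V.valuation (x i) < 1)
    (hxi : ∀ m : Fin ρ → ℤ, (∃ b ∈ K, (∏ i, V.valuation (x i) ^ (m i)) = V.valuation b) → m = 0)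
    (hy : ∀ j, y j ∈ V) (hri : AlgebraicIndependent (resField V K) (fun j => residue V ⟨y j, hy j⟩))
    {a : Ω} (ha : a ∈ Subring.closure ((K : Set Ω) ∪ (Set.range x ∪ Set.range y))) :
    V.valuation a < 1 ↔ ∃ Q : Fin ρ → MvPolynomial (Fin ρ) (MvPolynomial (Fin τ) K),
      a = ∑ i, MvPolynomial.eval₂Hom (MvPolynomial.aeval y).toRingHom x (Q i) * x i := by
  classical
  have hRV := closure_le_valuationSubring V K hKV x y hx1 hy
  constructor
  · intro hva
    obtain ⟨F, rfl⟩ := exists_eval₂_eq_of_mem_closure K x y ha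
    by_cases hF : F = 0
    · refine ⟨fun _ => 0, ?_⟩
      simp [hF]
    -- the dominant term
    obtain ⟨e₀, he₀, d₀, hd₀, hdom, h, -, ε, -, hvh, -, hvε, hdec⟩ :=
      exists_dominant_term V K x y hx0 hxi hy hri F hF
    have hcoef : ∀ (e : Fin ρ →₀ ℕ) (d : Fin τ →₀ ℕ), d ∈ (F.coeff e).support →
        V.valuation ((((F.coeff e).coeff d : K) : Ω)) = 1 := fun e d hd =>
      valuation_eq_one_of_subfield_subset V (F := K) hKV ((F.coeff e).coeff d).2
        (by exact_mod_cast MvPolynomial.mem_support_iff.mp hd)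
    have hva' : V.valuation (MvPolynomial.eval₂Hom (MvPolynomial.aeval y).toRingHom x F) =
        ∏ i, V.valuation (x i) ^ (e₀ i) := by
      change V.valuation (MvPolynomial.eval₂ (MvPolynomial.aeval y).toRingHom x F) = _
      rw [hdec]
      simp only [map_mul, map_prod, map_pow, hcoef e₀ d₀ hd₀, hvh, V.valuation.map_one_add_of_lt hvε, one_mul, mul_one]
    -- no `x`-free term
    have hsupp : ∀ m ∈ F.support, ∃ i ∈ (Set.univ : Set (Fin ρ)), (m : Fin ρ →₀ ℕ) i ≠ 0 := by
      intro m hm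
      by_contra hcon
      have hm0 : m = 0 := Finsupp.ext fun i => by
        by_contra hi
        exact hcon ⟨i, Set.mem_univ i, hi⟩
      subst hm0
      obtain ⟨d, hd⟩ := MvPolynomial.support_nonempty.mpr (MvPolynomial.mem_support_iff.mp hm)
      have h1 := hdom 0 hm d hd
      rw [hcoef 0 d hd, hcoef e₀ d₀ hd₀, one_mul, one_mul] at h1
      simp only [Finsupp.coe_zero, Pi.zero_apply, pow_zero, Finset.prod_const_one] at h1
      rw [← hva'] at h1
      exact absurd hva (not_lt.mpr h1)
    have hmem : F ∈ Ideal.span (Set.range (MvPolynomial.X : Fin ρ → MvPolynomial (Fin ρ) (MvPolynomial (Fin τ) K))) := by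
      rw [← Set.image_univ]
      exact MvPolynomial.mem_ideal_span_X_image.mpr hsupp
    obtain ⟨Q, hQ⟩ := Ideal.mem_span_range_iff_exists_fun.mp hmem
    refine ⟨Q, ?_⟩
    conv_lhs => rw [← hQ]
    rw [map_sum]
    exact Finset.sum_congr rfl fun i _ => by rw [map_mul, MvPolynomial.eval₂Hom_X']
  · rintro ⟨Q, rfl⟩
    refine V.valuation.map_sum_lt one_ne_zero fun i _ => ?_
    rw [map_mul]
    calc V.valuation (MvPolynomial.eval₂Hom (MvPolynomial.aeval y).toRingHom x (Q i)) * V.valuation (x i)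
        ≤ 1 * V.valuation (x i) :=
          mul_le_mul' ((V.valuation_le_one_iff _).mpr (hRV (eval₂Hom_mem_closure K x y (Q i)))) le_rfl
      _ < 1 := by rw [one_mul]; exact hx1 i

end KK05ValueBasis

end Summit.ResolutionOfSingularities.ResolutionOfSingularities.Theorems.RadicialJung.CleanModels

end
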